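import Literature.Geometry.Riemannian.DistSqDirectionalDatum
import HarnessLib

/-!
# The one-ended directional datum of `d_t(x₀, ·)²` at `y ≠ x₀` under a two-sided Ricci bound on
# the ball `{d_t(x₀, ·) ≤ d_t(x₀, y)}` (Bamler 2020a, §9: `H_n`-centres stay near the basepoint)

R. Bamler, *Entropy and heat kernel bounds on a Ricci flow background*, arXiv:2008.07093 (2020a),
§9 (arXiv Lemma 37, the subsolution `e^{−Ct} φ(d_t(x₀, ·))`): on a Ricci flow with `|Ric| ≤ K`
near `x₀` one needs `□ d_t(x₀, ·)² ≤ 2n + O(K d²)` in the barrier sense; the inputs are Laplace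
comparison `Δ d² ≤ 2n + (2/3) K d²` (second variation along LINEARLY weighted parallel fields
`(s/d) eᵢ(s)`) and `∂ₜ d_t² ≥ −2d ∫ Ric(γ̇, γ̇) ≥ −2Kd²`. We prove this ONE-ENDED DIRECTIONAL DATUM
(the shape consumed by `directional_barrier_maximum_principle`) for `ψ = d_t(x₀, ·)²` at `y ≠ x₀`:

* `exists_linear_cutoff` — a `C^∞` profile equal to `s/T` near `[0, T]`, zero off `(−1/2, T + 1/2)`;
* `far_end_linear_datum` — along `γ(t) = exp_p(tu)`: an orthonormal frame at `γ(T)` headed by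
  `γ̇(T)`, the radial barrier `d(p, exp_{γT}(σ f none)) ≤ T + σ`, the transverse Taylor barriers
  from the fields `(s/T) eₒ(s)` (`HaslhoferMuller.edist_toReal_le_taylor`), and the trace identity
  `Σₒ Qₒ − Q none = −∫₀ᵀ (s/T)² Ric(γ̇, γ̇) ds + (dim M − 1)/T`;
* `end_distSq_barriers_linear` — polynomial upper barriers for `d(p, ·)²` at `γ(T)` with
  `Σᵢ bᵢ ≤ 2 dim M − 2T ∫₀ᵀ (s/T)² Ric(γ̇, γ̇) ds + ε₁`;
* `distSq_basepoint_directional_datum` — on a compact Ricci flow, with `T = d_t(x₀, y)`: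
  `Σᵢ bᵢ ≤ 2m + K T² + η` (`|Ric(γ̇, γ̇)| ≤ K` along the minimising geodesic, which stays in the
  ball) and the linear left time barrier of slope `p ≥ −2KT² − η`
  (`IsRicciFlow.edist_toReal_sq_le_taylor_left`).

Everything is proved; no definitions, no named facts.

## References

* R. H. Bamler, *Entropy and heat kernel bounds on a Ricci flow background*, arXiv:2008.07093
  (2020), §3.2 (proof of Thm. 3.5) and §9 (arXiv Lemma 37). [Bamler2020Entropy]
* J. M. Lee, *Introduction to Riemannian Manifolds* (2018), Thm. 10.22 (second variation),
  Thm. 11.15 (Laplacian comparison). [LeeRiemannianManifolds2018]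
-/
noncomputable section

open Bundle Set Function Filter MeasureTheory intervalIntegral
open scoped Manifold ContDiff Topology ENNReal NNReal Real

namespace Literature.Geometry.Riemannian

open Lorentzian Lorentzian.PseudoRiemannianMetric

/-! ### The smooth linear profile with compact support -/

/-- **A `C^∞` profile equal to `s/T` near `[0, T]` and vanishing off `(−1/2, T + 1/2)`**
(product of `s/T` with a smooth plateau bump from `Real.smoothTransition`). [folklore] -/
theorem exists_linear_cutoff (T : ℝ) :
    ∃ φ : ℝ → ℝ, ContDiff ℝ ∞ φ ∧
      (∀ s ∈ Ioo (-(1 / 4 : ℝ)) (T + 1 / 4), φ s = s / T) ∧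
      (∀ s, s ≤ -(1 / 2 : ℝ) → φ s = 0) ∧ (∀ s, T + 1 / 2 ≤ s → φ s = 0) := by
  refine ⟨fun s ↦ (Real.smoothTransition (4 * s + 2) * Real.smoothTransition (4 * (T - s) + 2)) *
    (s / T), ?_, ?_, ?_, ?_⟩
  · exact ((Real.smoothTransition.contDiff.comp ((contDiff_const.mul contDiff_id).add contDiff_const)).mul
      (Real.smoothTransition.contDiff.comp ((contDiff_const.mul (contDiff_const.sub contDiff_id)).add
        contDiff_const))).mul (contDiff_id.div_const _)
  · intro s hs
    simp only
    rw [Real.smoothTransition.one_of_one_le (by linarith [hs.1]),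
      Real.smoothTransition.one_of_one_le (by linarith [hs.2]), one_mul, one_mul]
  · intro s hs
    simp only
    rw [Real.smoothTransition.zero_of_nonpos (by linarith), zero_mul, zero_mul]
  · intro s hs
    simp only
    rw [Real.smoothTransition.zero_of_nonpos (x := 4 * (T - s) + 2) (by linarith), mul_zero, zero_mul]

section FarEnd

variable {E : Type*} [NormedAddCommGroup E] [NormedSpace ℝ E] [FiniteDimensional ℝ E]
  [CompleteSpace E] {M : Type*} [TopologicalSpace M] [ChartedSpace E M] [IsManifold 𝓘(ℝ, E) ∞ M]
  [T2Space M]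
  (g : PseudoRiemannianMetric 𝓘(ℝ, E) ∞ E (TangentSpace 𝓘(ℝ, E) : M → Type _)) [g.HasLeviCivita]
  [CovariantDerivative.ContMDiffCovariantDerivative g.leviCivita 1]
  [CovariantDerivative.ContMDiffCovariantDerivative g.leviCivita ∞]

/-- **The linearly weighted directional datum at the far end of a unit speed geodesic**
`γ(t) = exp_p(tu)`, `T > 0`, on a complete Riemannian manifold: a `g`-orthonormal frame `f` at
`γ(T)` headed by `γ̇(T)`; the exact radial barrier `d(p, exp_{γT}(σ f none)) ≤ T + σ` for
`|σ| < T`; for every `ε > 0` the barriers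
`d(p, exp_{γT}(σ f o)) ≤ T + [o = none] σ + (Q o + εT)/2 · σ²` for `σ` near `0` along the LINEAR
fields `(s/T) eₒ(s)` of a parallel frame (second variation, `HaslhoferMuller.edist_toReal_le_taylor`);
and the trace identity `Σₒ Q o − Q none = −∫₀ᵀ (s/T)² Ric(γ̇, γ̇) ds + (dim M − 1)/T`.
[cite: LeeRiemannianManifolds2018, Thm. 10.22 and Thm. 11.15 (proof)] -/
theorem far_end_linear_datum (hg : g.IsRiemannian) (hc : IsGeodesicallyComplete g.leviCivita)
    (p : M) (u : TangentSpace 𝓘(ℝ, E) p) (hu : g.val p u u = 1) {T : ℝ} (hT : 0 < T) :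
    ∃ (k : ℕ) (f : Option (Fin k) → TangentSpace 𝓘(ℝ, E) (expMap g.leviCivita p (T • u)))
      (Q : Option (Fin k) → ℝ),
      Fintype.card (Option (Fin k)) = Module.finrank ℝ E ∧
      (∀ o o', g.val (expMap g.leviCivita p (T • u)) (f o) (f o') = if o = o' then 1 else 0) ∧
      f none = velocity 𝓘(ℝ, E) (fun t ↦ expMap g.leviCivita p (t • u)) T ∧
      (∀ σ ∈ Ioo (-T) T, (g.edist hg p
        (expMap g.leviCivita (expMap g.leviCivita p (T • u)) (σ • f none))).toReal ≤ T + σ) ∧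
      (∀ o, ∀ ε > 0, ∀ᶠ σ in 𝓝 (0 : ℝ),
        (g.edist hg p (expMap g.leviCivita (expMap g.leviCivita p (T • u)) (σ • f o))).toReal ≤
          T + (if o = none then σ else 0) + (Q o + ε * T) / 2 * σ ^ 2) ∧
      (∑ o, Q o) - Q none =
        -(∫ s in (0 : ℝ)..T, (s / T) ^ 2 *
            g.leviCivita.ricci (expMap g.leviCivita p (s • u))
              (velocity 𝓘(ℝ, E) (fun t ↦ expMap g.leviCivita p (t • u)) s)
              (velocity 𝓘(ℝ, E) (fun t ↦ expMap g.leviCivita p (t • u)) s)) +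
          ((Module.finrank ℝ E : ℝ) - 1) / T := by
  classical
  have hLC := PseudoRiemannianMetric.isLeviCivita_leviCivita_holds (g := g)
  have hreg : g.leviCivita.IsLocallyContMDiff ∞ := hLC.isLocallyContMDiff ⊤ (le_of_eq rfl)
  have hreg1 : g.leviCivita.IsLocallyContMDiff 1 := hLC.isLocallyContMDiff 1 (by exact_mod_cast le_top)
  have h2 : (2 : ℕ∞ω) ≤ (∞ : ℕ∞ω) := WithTop.coe_le_coe.2 le_top
  haveI : Fact ((1 : ℕ∞ω) ≤ (∞ : ℕ∞ω)) := ⟨by exact_mod_cast le_top⟩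
  -- the geodesic
  set γ : ℝ → M := fun t ↦ expMap g.leviCivita p (t • u) with hγ_def
  have hgeo : IsGeodesic g.leviCivita γ := isGeodesic_expMap_smul_of_isGeodesicallyComplete hc p u
  have hγfun : γ = maximalGeodesic g.leviCivita p u := funext fun t ↦ expMap_smul hc p u t
  have hγs : ContMDiff 𝓘(ℝ, ℝ) 𝓘(ℝ, E) ∞ γ := by
    rw [hγfun]
    exact (contMDiff_maximalGeodesic_family hc p).comp
      (contMDiff_id.prodMk (contMDiff_const (c := (show E from u))))
  have hγd : ∀ t, MDifferentiableAt 𝓘(ℝ, ℝ) 𝓘(ℝ, E) γ t := fun t ↦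
    mdifferentiableAt_of_mdifferentiableAt_lift (hgeo.1 t (mem_univ t))
  have hγc : ∀ t, ContinuousAt (tangentLift 𝓘(ℝ, E) γ) t := fun t ↦
    (hgeo.1 t (mem_univ t)).continuousAt
  have hγ0 : γ 0 = p := by
    show expMap g.leviCivita p ((0 : ℝ) • u) = p
    rw [zero_smul]; exact expMap_zero (cov := g.leviCivita) p
  have hspeed : ∀ t, g.val (γ t) (velocity 𝓘(ℝ, E) γ t) (velocity 𝓘(ℝ, E) γ t) = 1 := by
    intro t
    have h := g.val_velocity_eq_of_isGeodesicOn_holds isOpen_univ ordConnected_univ hgeo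
      (mem_univ t) (mem_univ 0)
    have hv0 : (velocity 𝓘(ℝ, E) γ 0 : E) = (u : E) := velocity_expMap_smul_zero p u
    rw [h, hv0, hγ0, hu]
  -- the frame at `γ T` headed by `γ̇ T`, transported along `γ` on `(-1, T + 1)`
  obtain ⟨k, f₀, hf₀none, hf₀on, hcard⟩ := exists_orthonormal_frame_with_head g hg (γ T) (hspeed T)
  have hT₀ : T ∈ Ioo (-1 : ℝ) (T + 1) := ⟨by linarith, by linarith⟩
  obtain ⟨e, he0, hepar, heon⟩ :=
    exists_parallel_orthonormal_frame_Ioo' g hg hLC.2 hreg hγd hγc hT₀ f₀ hf₀on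
  have helift : ∀ o, ∀ t ∈ Ioo (-1 : ℝ) (T + 1), ContMDiffAt 𝓘(ℝ, ℝ) 𝓘(ℝ, E).tangent ∞
      (fun t ↦ (TotalSpace.mk' E (γ t) (e o t) : TangentBundle 𝓘(ℝ, E) M)) t := fun o t ht ↦
    HaslhoferMuller.contMDiffAt_lift_of_isParallelAlongOn g.leviCivita hreg hγs isOpen_Ioo
      (hepar o) ht
  -- the head of the frame is the velocity (both are parallel and agree at `T`)
  have hhead : ∀ t ∈ Ioo (-1 : ℝ) (T + 1), e none t = velocity 𝓘(ℝ, E) γ t := by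
    intro t ht
    have hvelpar : IsParallelAlongOn g.leviCivita γ (fun t ↦ velocity 𝓘(ℝ, E) γ t)
        (Ioo (-1 : ℝ) (T + 1)) :=
      (IsGeodesicOn.isParallelAlongOn_velocity (hgeo.isGeodesicOn univ)).mono (subset_univ _)
    exact eq_of_isParallelAlongOn g hg hLC.2 ordConnected_Ioo (hepar none) hvelpar hT₀
      ((he0 none).trans hf₀none) ht
  -- the profile and the variation fields `X_o = φ • e_o`
  obtain ⟨φ, hφs, hφlin, hφneg, hφge⟩ := exists_linear_cutoff T
  set X : Option (Fin k) → Π t : ℝ, TangentSpace 𝓘(ℝ, E) (γ t) := fun o t ↦ φ t • e o t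
    with hX_def
  have hzeroLift : ContMDiff 𝓘(ℝ, ℝ) 𝓘(ℝ, E).tangent ∞
      (fun t ↦ (TotalSpace.mk' E (γ t) (0 : TangentSpace 𝓘(ℝ, E) (γ t)) :
        TangentBundle 𝓘(ℝ, E) M)) :=
    (contMDiff_zeroSection ℝ (TangentSpace 𝓘(ℝ, E) : M → Type _)).comp hγs
  have hXs : ∀ o, ContMDiff 𝓘(ℝ, ℝ) 𝓘(ℝ, E).tangent ∞
      (fun t ↦ (TotalSpace.mk' E (γ t) (X o t) : TangentBundle 𝓘(ℝ, E) M)) := by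
    intro o t
    by_cases ht : t ∈ Ioo (-1 : ℝ) (T + 1)
    · exact contMDiffAt_liftAlong_smul (helift o t ht) (hφs.contDiffAt.contMDiffAt)
    · refine (hzeroLift t).congr_of_eventuallyEq ?_
      rcases le_or_gt t (-1) with hle | hgt
      · filter_upwards [(isOpen_gt' (-(1 / 2) : ℝ)).mem_nhds (show t < -(1 / 2) by linarith)] with s hs
        show (TotalSpace.mk' E (γ s) (X o s) : TangentBundle 𝓘(ℝ, E) M) =
          TotalSpace.mk' E (γ s) (0 : TangentSpace 𝓘(ℝ, E) (γ s))
        rw [hX_def]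
        simp only [hφneg s (le_of_lt hs), zero_smul]
      · have hge : T + 1 ≤ t := by
          by_contra hlt
          exact ht ⟨hgt, lt_of_not_ge hlt⟩
        filter_upwards [(isOpen_lt' (T + 1 / 2)).mem_nhds (show T + 1 / 2 < t by linarith)]
          with s hs
        show (TotalSpace.mk' E (γ s) (X o s) : TangentBundle 𝓘(ℝ, E) M) =
          TotalSpace.mk' E (γ s) (0 : TangentSpace 𝓘(ℝ, E) (γ s))
        rw [hX_def]
        simp only [hφge s (le_of_lt hs), zero_smul]
  have hφ0 : φ 0 = 0 := by rw [hφlin 0 ⟨by norm_num, by linarith⟩, zero_div]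
  have hφT : φ T = 1 := by rw [hφlin T ⟨by linarith, by linarith⟩, div_self hT.ne']
  have hX0 : ∀ o, X o 0 = 0 := fun o ↦ by
    show φ 0 • e o 0 = 0; rw [hφ0, zero_smul]
  have hXT : ∀ o, X o T = f₀ o := fun o ↦ by
    show φ T • e o T = f₀ o; rw [hφT, one_smul, he0]
  -- the index integrands and their integrals
  set qf : Option (Fin k) → ℝ → ℝ := fun o t ↦
    g.val (γ t) (g.leviCivita.curvature (γ t) (X o t) (velocity 𝓘(ℝ, E) γ t) (X o t))
        (velocity 𝓘(ℝ, E) γ t) +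
      g.val (γ t) (covariantDerivAlong g.leviCivita γ (X o) t)
        (covariantDerivAlong g.leviCivita γ (X o) t) with hqf_def
  have hqfc : ∀ o, Continuous (qf o) := fun o ↦
    (integral_energy_le_taylor g le_rfl hc (hXs o) hT.le).1
  set Q : Option (Fin k) → ℝ := fun o ↦ ∫ t in (0 : ℝ)..T, qf o t with hQ_def
  -- the Taylor barriers (every direction, every `ε`)
  have hbar : ∀ o, ∀ ε > 0, ∀ᶠ σ in 𝓝 (0 : ℝ),
      (g.edist hg p (expMap g.leviCivita (expMap g.leviCivita p (T • u)) (σ • f₀ o))).toReal ≤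
        T + (if o = none then σ else 0) + (Q o + ε * T) / 2 * σ ^ 2 := by
    intro o ε hε
    obtain ⟨δ, hδ, hδ'⟩ :=
      HaslhoferMuller.edist_toReal_le_taylor g le_rfl hg hc p u hu (hXs o) (hX0 o) hT ε hε
    filter_upwards [Icc_mem_nhds (show -δ < 0 by linarith) hδ] with σ hσ
    have h := hδ' σ hσ
    have ha : g.val (expMap g.leviCivita p (T • u)) (f₀ o)
        (velocity 𝓘(ℝ, E) (fun t ↦ expMap g.leviCivita p (t • u)) T) =
        if o = none then 1 else 0 := by
      show g.val (γ T) (f₀ o) (velocity 𝓘(ℝ, E) γ T) = _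
      rw [← hf₀none, hf₀on]
    rw [hXT] at h
    rw [ha] at h
    have hif : σ * (if o = none then (1 : ℝ) else 0) = if o = none then σ else 0 := by
      split_ifs <;> simp
    calc (g.edist hg p (expMap g.leviCivita (expMap g.leviCivita p (T • u)) (σ • f₀ o))).toReal
        ≤ T + σ * (if o = none then (1 : ℝ) else 0) + σ ^ 2 * ((Q o) + ε * T) / 2 := h
      _ = T + (if o = none then σ else 0) + (Q o + ε * T) / 2 * σ ^ 2 := by rw [hif]; ring
  -- the exact radial barrier
  have hrad : ∀ σ ∈ Ioo (-T) T, (g.edist hg p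
      (expMap g.leviCivita (expMap g.leviCivita p (T • u)) (σ • f₀ none))).toReal ≤ T + σ := by
    intro σ hσ
    rw [hf₀none, expMap_smul_velocity_eq g hc p u T σ]
    have h1 := (edist_toReal_le_of_unit_speed g hg hγs (T' := T + σ) (by linarith [hσ.1]) hspeed).2
    rwa [hγ0] at h1
  -- (A) the index integrand of `X_o` in the frame, on the interval
  have hφd : ∀ t, DifferentiableAt ℝ φ t := fun t ↦ (hφs.differentiable (by simp)).differentiableAt
  have hqf : ∀ o, ∀ t ∈ Ioo (-1 : ℝ) (T + 1), qf o t =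
      -(φ t ^ 2 * g.val (γ t) (g.leviCivita.curvature (γ t) (e o t) (velocity 𝓘(ℝ, E) γ t)
        (velocity 𝓘(ℝ, E) γ t)) (e o t)) + deriv φ t ^ 2 := by
    intro o t ht
    have hD : covariantDerivAlong g.leviCivita γ (X o) t = deriv φ t • e o t := by
      have h := covariantDerivAlong_smul_holds g.leviCivita (γ := γ) (W := e o) (f := φ) (t₀ := t)
        (hφd t) (hepar o t ht).1
      rw [(hepar o t ht).2, smul_zero, add_zero] at h
      exact h
    have hcurv : g.val (γ t) (g.leviCivita.curvature (γ t) (X o t) (velocity 𝓘(ℝ, E) γ t) (X o t))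
        (velocity 𝓘(ℝ, E) γ t) = φ t ^ 2 * g.val (γ t) (g.leviCivita.curvature (γ t) (e o t)
          (velocity 𝓘(ℝ, E) γ t) (e o t)) (velocity 𝓘(ℝ, E) γ t) := by
      show g.val (γ t) (g.leviCivita.curvature (γ t) (φ t • e o t) (velocity 𝓘(ℝ, E) γ t)
        (φ t • e o t)) (velocity 𝓘(ℝ, E) γ t) = _
      simp only [map_smul, FunLike.coe_smul, Pi.smul_apply, smul_eq_mul]
      ring
    have hskew := hLC.val_curvature_skew h2 (γ t) (e o t) (velocity 𝓘(ℝ, E) γ t) (e o t)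
      (velocity 𝓘(ℝ, E) γ t)
    have hDD : g.val (γ t) (covariantDerivAlong g.leviCivita γ (X o) t)
        (covariantDerivAlong g.leviCivita γ (X o) t) = deriv φ t ^ 2 := by
      rw [hD]
      simp only [map_smul, FunLike.coe_smul, Pi.smul_apply, smul_eq_mul]
      rw [heon t ht o o, if_pos rfl]
      ring
    show g.val (γ t) (g.leviCivita.curvature (γ t) (X o t) (velocity 𝓘(ℝ, E) γ t) (X o t))
        (velocity 𝓘(ℝ, E) γ t) + g.val (γ t) (covariantDerivAlong g.leviCivita γ (X o) t)
        (covariantDerivAlong g.leviCivita γ (X o) t) = _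
    rw [hcurv, hDD, hskew]
    ring
  -- the radial curvature term vanishes (`e none = γ̇`)
  have hqfnone : ∀ t ∈ Ioo (-1 : ℝ) (T + 1), qf none t = deriv φ t ^ 2 := by
    intro t ht
    rw [hqf none t ht, hhead t ht,
      val_curvature_self_eq_zero hLC.2 hreg1 h2 (γ t) (velocity 𝓘(ℝ, E) γ t) (velocity 𝓘(ℝ, E) γ t)
        (velocity 𝓘(ℝ, E) γ t)]
    ring
  -- (B) summing over the frame: `Σ_o q_o = −φ² Ric(γ̇,γ̇) + card · φ'²`
  have hsum : ∀ t ∈ Ioo (-1 : ℝ) (T + 1), ∑ o, qf o t =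
      -(φ t ^ 2 * g.leviCivita.ricci (γ t) (velocity 𝓘(ℝ, E) γ t) (velocity 𝓘(ℝ, E) γ t)) +
        (Fintype.card (Option (Fin k)) : ℝ) * deriv φ t ^ 2 := by
    intro t ht
    have hric := sum_val_curvature_eq_ricci g g.leviCivita (γ t) (heon t ht) hcard
      (velocity 𝓘(ℝ, E) γ t)
    rw [Finset.sum_congr rfl fun o _ ↦ hqf o t ht, Finset.sum_add_distrib, Finset.sum_const,
      Finset.card_univ, nsmul_eq_mul, Finset.sum_neg_distrib, ← Finset.mul_sum, hric]
  -- (C) the integrals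
  have hIoo : uIcc (0 : ℝ) T ⊆ Ioo (-1 : ℝ) (T + 1) := by
    rw [uIcc_of_le hT.le]
    exact fun t ht ↦ ⟨by linarith [ht.1], by linarith [ht.2]⟩
  have hIcc' : uIcc (0 : ℝ) T ⊆ Ioo (-(1 / 4) : ℝ) (T + 1 / 4) := by
    rw [uIcc_of_le hT.le]
    exact fun t ht ↦ ⟨by linarith [ht.1], by linarith [ht.2]⟩
  -- `deriv φ = 1/T` on the interval
  have hφ' : ∀ t ∈ Ioo (-(1 / 4) : ℝ) (T + 1 / 4), deriv φ t = 1 / T := by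
    intro t ht
    have hev : φ =ᶠ[𝓝 t] fun s ↦ s / T :=
      eventuallyEq_of_mem (isOpen_Ioo.mem_nhds ht) fun s hs ↦ hφlin s hs
    rw [hev.deriv_eq]
    exact (by simpa using (hasDerivAt_id t).div_const T : HasDerivAt (fun s : ℝ ↦ s / T) (1 / T) t).deriv
  have hI1T : ∫ _ in (0 : ℝ)..T, (1 / T) ^ 2 = 1 / T := by
    rw [intervalIntegral.integral_const, smul_eq_mul, sub_zero]; field_simp
  have hric_c : Continuous fun t ↦ g.leviCivita.ricci (γ t) (velocity 𝓘(ℝ, E) γ t) (velocity 𝓘(ℝ, E) γ t) := by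
    have hTl := contMDiff_lift_velocity_of_contMDiff (I := 𝓘(ℝ, E)) hγs
    exact (show ContMDiff 𝓘(ℝ, ℝ) 𝓘(ℝ, ℝ) ∞ _ from fun t ↦
      contMDiffAt_ricci_apply_along g (hTl t) (hTl t)).continuous
  have hsumQ : ∑ o, Q o = -(∫ t in (0 : ℝ)..T, (t / T) ^ 2 *
      g.leviCivita.ricci (γ t) (velocity 𝓘(ℝ, E) γ t) (velocity 𝓘(ℝ, E) γ t)) +
      (Fintype.card (Option (Fin k)) : ℝ) * (1 / T) := by
    have h1 : ∑ o, Q o = ∫ t in (0 : ℝ)..T, ∑ o, qf o t := by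
      rw [intervalIntegral.integral_finsetSum]
      exact fun o _ ↦ (hqfc o).intervalIntegrable _ _
    rw [h1, intervalIntegral.integral_congr fun t ht ↦ hsum t (hIoo ht)]
    have hI1 : IntervalIntegrable (fun t ↦ -(φ t ^ 2 *
        g.leviCivita.ricci (γ t) (velocity 𝓘(ℝ, E) γ t) (velocity 𝓘(ℝ, E) γ t))) volume 0 T :=
      ((hφs.continuous.pow 2).mul hric_c).neg.intervalIntegrable _ _
    have hI2 : IntervalIntegrable (fun t ↦ (Fintype.card (Option (Fin k)) : ℝ) * deriv φ t ^ 2) volume 0 T :=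
      (continuous_const.mul ((hφs.continuous_deriv (by simp)).pow 2)).intervalIntegrable _ _
    rw [intervalIntegral.integral_add hI1 hI2, intervalIntegral.integral_neg,
      intervalIntegral.integral_const_mul]
    congr 1
    · congr 1
      exact intervalIntegral.integral_congr fun t ht ↦ by
        show φ t ^ 2 * _ = (t / T) ^ 2 * _
        rw [hφlin t (hIcc' ht)]
    · congr 1
      rw [intervalIntegral.integral_congr (g := fun _ ↦ (1 / T) ^ 2)
        (fun t ht ↦ by simp only; rw [hφ' t (hIcc' ht)]), hI1T]
  have hQnone : Q none = 1 / T := by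
    show ∫ t in (0 : ℝ)..T, qf none t = _
    rw [intervalIntegral.integral_congr fun t ht ↦ hqfnone t (hIoo ht),
      intervalIntegral.integral_congr (g := fun _ ↦ (1 / T) ^ 2)
        (fun t ht ↦ by simp only; rw [hφ' t (hIcc' ht)]), hI1T]
  -- (D) assembly
  refine ⟨k, f₀, Q, hcard, hf₀on, hf₀none, hrad, hbar, ?_⟩
  have hcardR : (Fintype.card (Option (Fin k)) : ℝ) = (Module.finrank ℝ E : ℝ) := by
    exact_mod_cast hcard
  rw [hsumQ, hQnone, hcardR]
  field_simp
  ring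


/-- **Spatial directional barriers for `d(p, ·)²` at the far end `y₀ = exp_p(Tu)` of a unit speed
geodesic, linear weight** (complete Riemannian manifold, `T > 0`, `ε₁ > 0`): a `g`-orthonormal
frame `e` at `y₀` indexed by `Fin (dim M)`, polynomial upper barriers `Bᵢ(σ) ≥ d(p, exp_{y₀}(σ eᵢ))²`
for `σ` near `0` with `Bᵢ(0) = T²`, derivatives `Bᵢ′` and second derivatives `bᵢ` at `0`, and
`Σᵢ bᵢ ≤ 2 dim M − 2T ∫₀ᵀ (s/T)² Ric(γ̇, γ̇) ds + ε₁` (the radial barrier `(T + σ)²`, the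
transverse ones `T² + (2Tqₒ + ε)σ²`). [cite: LeeRiemannianManifolds2018, Thm. 11.15 (proof)] -/
theorem end_distSq_barriers_linear (hg : g.IsRiemannian) (hc : IsGeodesicallyComplete g.leviCivita)
    (p : M) (u : TangentSpace 𝓘(ℝ, E) p) (hu : g.val p u u = 1) {T : ℝ} (hT : 0 < T)
    {ε₁ : ℝ} (hε₁ : 0 < ε₁) :
    ∃ (e : Fin (Module.finrank ℝ E) → TangentSpace 𝓘(ℝ, E) (expMap g.leviCivita p (T • u)))
      (B B' : Fin (Module.finrank ℝ E) → ℝ → ℝ) (b : Fin (Module.finrank ℝ E) → ℝ),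
      (∀ i j, g.val (expMap g.leviCivita p (T • u)) (e i) (e j) = if i = j then 1 else 0) ∧
      (∀ i, (∀ᶠ σ in 𝓝 (0 : ℝ), HasDerivAt (B i) (B' i σ) σ) ∧ HasDerivAt (B' i) (b i) 0 ∧
        B i 0 = T ^ 2 ∧
        ∀ᶠ σ in 𝓝 (0 : ℝ), (g.edist hg p
          (expMap g.leviCivita (expMap g.leviCivita p (T • u)) (σ • e i))).toReal ^ 2 ≤ B i σ) ∧
      ∑ i, b i ≤ 2 * (Module.finrank ℝ E : ℝ) -
        2 * T * (∫ s in (0 : ℝ)..T, (s / T) ^ 2 *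
            g.leviCivita.ricci (expMap g.leviCivita p (s • u))
              (velocity 𝓘(ℝ, E) (fun t ↦ expMap g.leviCivita p (t • u)) s)
              (velocity 𝓘(ℝ, E) (fun t ↦ expMap g.leviCivita p (t • u)) s)) + ε₁ := by
  classical
  obtain ⟨k, f, Q, hcard, hon, -, hrad, hbar, hQ⟩ := far_end_linear_datum g hg hc p u hu hT
  -- sizes
  have hk : (k : ℝ) = (Module.finrank ℝ E : ℝ) - 1 := by
    have : Fintype.card (Option (Fin k)) = k + 1 := by simp
    rw [this] at hcard
    have : ((k + 1 : ℕ) : ℝ) = (Module.finrank ℝ E : ℝ) := by exact_mod_cast hcard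
    push_cast at this; linarith
  -- the inner slack
  set ε : ℝ := ε₁ / (2 * ((k : ℝ) + 1) * (T ^ 2 + 1)) with hε_def
  have hε : 0 < ε := by positivity
  -- reindexing `Fin (dim M) ≃ Option (Fin k)`
  have hcardF : Fintype.card (Fin (Module.finrank ℝ E)) = Fintype.card (Option (Fin k)) := by
    rw [Fintype.card_fin, hcard]
  set ι : Fin (Module.finrank ℝ E) ≃ Option (Fin k) := Fintype.equivOfCardEq hcardF with hι
  -- the barriers per direction `o`
  set q : Option (Fin k) → ℝ := fun o ↦ (Q o + ε * T) / 2 with hq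
  set Bq : Option (Fin k) → ℝ → ℝ := fun o σ ↦
    if o = none then (T + σ) ^ 2 else T ^ 2 + (2 * T * q o + ε) * σ ^ 2 with hBq
  set Bq' : Option (Fin k) → ℝ → ℝ := fun o σ ↦
    if o = none then 2 * (T + σ) else 2 * (2 * T * q o + ε) * σ with hBq'
  set bq : Option (Fin k) → ℝ := fun o ↦ if o = none then 2 else 2 * (2 * T * q o + ε) with hbq
  have hBd : ∀ o σ, HasDerivAt (Bq o) (Bq' o σ) σ := by
    intro o σ
    by_cases ho : o = none
    · have h1 : HasDerivAt (fun x : ℝ ↦ (T + x) ^ 2) (2 * (T + σ)) σ :=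
        ((hasDerivAt_pow 2 (T + σ)).comp σ ((hasDerivAt_id' σ).const_add T)).congr_deriv (by ring)
      have e1 : Bq o = fun x : ℝ ↦ (T + x) ^ 2 := by funext x; simp [hBq, ho]
      have e2 : Bq' o σ = 2 * (T + σ) := by simp [hBq', ho]
      rw [e1, e2]; exact h1
    · have h1 : HasDerivAt (fun x : ℝ ↦ T ^ 2 + (2 * T * q o + ε) * x ^ 2)
          (2 * (2 * T * q o + ε) * σ) σ :=
        (((hasDerivAt_pow 2 σ).const_mul (2 * T * q o + ε)).const_add (T ^ 2)).congr_deriv (by ring)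
      have e1 : Bq o = fun x : ℝ ↦ T ^ 2 + (2 * T * q o + ε) * x ^ 2 := by funext x; simp [hBq, ho]
      have e2 : Bq' o σ = 2 * (2 * T * q o + ε) * σ := by simp [hBq', ho]
      rw [e1, e2]; exact h1
  have hB'd : ∀ o, HasDerivAt (Bq' o) (bq o) 0 := by
    intro o
    by_cases ho : o = none
    · have h1 : HasDerivAt (fun x : ℝ ↦ 2 * (T + x)) 2 0 :=
        (((hasDerivAt_id' (0 : ℝ)).const_add T).const_mul 2).congr_deriv (by ring)
      have e1 : Bq' o = fun x : ℝ ↦ 2 * (T + x) := by funext x; simp [hBq', ho]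
      have e2 : bq o = 2 := by simp [hbq, ho]
      rw [e1, e2]; exact h1
    · have h1 : HasDerivAt (fun x : ℝ ↦ 2 * (2 * T * q o + ε) * x) (2 * (2 * T * q o + ε)) 0 :=
        ((hasDerivAt_id' (0 : ℝ)).const_mul (2 * (2 * T * q o + ε))).congr_deriv (by ring)
      have e1 : Bq' o = fun x : ℝ ↦ 2 * (2 * T * q o + ε) * x := by funext x; simp [hBq', ho]
      have e2 : bq o = 2 * (2 * T * q o + ε) := by simp [hbq, ho]
      rw [e1, e2]; exact h1
  have hB0 : ∀ o, Bq o 0 = T ^ 2 := by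
    intro o; by_cases ho : o = none <;> simp [hBq, ho]
  -- domination
  have hdom : ∀ o, ∀ᶠ σ in 𝓝 (0 : ℝ), (g.edist hg p
      (expMap g.leviCivita (expMap g.leviCivita p (T • u)) (σ • f o))).toReal ^ 2 ≤ Bq o σ := by
    intro o
    by_cases ho : o = none
    · subst ho
      filter_upwards [Ioo_mem_nhds (show -T < 0 by linarith) hT] with σ hσ
      simp only [hBq, if_true]
      exact pow_le_pow_left₀ ENNReal.toReal_nonneg (hrad σ hσ) 2
    · filter_upwards [hbar o ε hε, eventually_sq_add_le T (q o) hε] with σ h1 h2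
      simp only [ho, if_false, add_zero] at h1
      simp only [hBq, ho, if_false]
      have h0 : 0 ≤ (g.edist hg p (expMap g.leviCivita (expMap g.leviCivita p (T • u)) (σ • f o))).toReal :=
        ENNReal.toReal_nonneg
      have h3 : (g.edist hg p (expMap g.leviCivita (expMap g.leviCivita p (T • u)) (σ • f o))).toReal ^ 2 ≤
          (T + q o * σ ^ 2) ^ 2 := pow_le_pow_left₀ h0 (by simpa [hq] using h1) 2
      exact h3.trans h2
  -- the sum of the second derivatives
  have hsumb : ∑ o, bq o = 2 + 2 * T * ((∑ o, Q o) - Q none) + (k : ℝ) * (2 * ε * T ^ 2 + 2 * ε) := by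
    rw [Fintype.sum_option, Fintype.sum_option]
    simp only [hbq, if_true, Option.some_ne_none, if_false, hq]
    rw [show ∑ x : Fin k, 2 * (2 * T * ((Q (some x) + ε * T) / 2) + ε) =
        ∑ x : Fin k, (2 * T * Q (some x) + (2 * ε * T ^ 2 + 2 * ε)) from
      Finset.sum_congr rfl fun x _ ↦ by ring, Finset.sum_add_distrib, Finset.sum_const,
      Finset.card_univ, Fintype.card_fin, nsmul_eq_mul, ← Finset.mul_sum]
    ring
  have hslack : (k : ℝ) * (2 * ε * T ^ 2 + 2 * ε) ≤ ε₁ := by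
    have hk0 : 0 ≤ (k : ℝ) := Nat.cast_nonneg k
    have e1 : (k : ℝ) * (2 * ε * T ^ 2 + 2 * ε) = ε₁ * ((k : ℝ) / ((k : ℝ) + 1)) := by
      rw [hε_def]; field_simp
    rw [e1]
    have h2 : (k : ℝ) / ((k : ℝ) + 1) ≤ 1 := by rw [div_le_one (by positivity)]; linarith
    nlinarith
  -- assembly
  refine ⟨fun i ↦ f (ι i), fun i ↦ Bq (ι i), fun i ↦ Bq' (ι i), fun i ↦ bq (ι i),
    fun i j ↦ ?_, fun i ↦ ⟨Eventually.of_forall fun σ ↦ hBd _ σ, hB'd _, hB0 _, hdom _⟩, ?_⟩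
  · simp only [hon, EmbeddingLike.apply_eq_iff_eq]
  · rw [Fintype.sum_equiv ι (fun i ↦ bq (ι i)) bq (fun i ↦ rfl), hsumb, hQ]
    rw [hk] at hslack ⊢
    have e : 2 * T * (((Module.finrank ℝ E : ℝ) - 1) / T) = 2 * ((Module.finrank ℝ E : ℝ) - 1) := by
      field_simp
    linarith [e, hslack]

end FarEnd

section Datum

variable {m : ℕ} {M : Type*} [TopologicalSpace M] [ChartedSpace (EuclideanSpace ℝ (Fin m)) M]
  [IsManifold 𝓘(ℝ, EuclideanSpace ℝ (Fin m)) ∞ M] [T2Space M] [CompactSpace M] [ConnectedSpace M]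
  {h : ℝ → PseudoRiemannianMetric 𝓘(ℝ, EuclideanSpace ℝ (Fin m)) ∞ (EuclideanSpace ℝ (Fin m))
    (TangentSpace 𝓘(ℝ, EuclideanSpace ℝ (Fin m)) : M → Type _)}
  [∀ r, (h r).HasLeviCivita]
  {cov : ℝ → CovariantDerivative 𝓘(ℝ, EuclideanSpace ℝ (Fin m)) (EuclideanSpace ℝ (Fin m))
    (TangentSpace 𝓘(ℝ, EuclideanSpace ℝ (Fin m)) : M → Type _)}

/-- **The one-ended directional datum of `d_t(x₀, ·)²` at `y ≠ x₀` under `|Ric| ≤ K` on the ball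
`{d_t(x₀, ·) ≤ d_t(x₀, y)}`** (compact Ricci flow, `t ∈ S` not the initial time, `η > 0`): an
`h(t)`-orthonormal frame at `y` headed by the direction of a minimising unit speed `h(t)`-geodesic
`γ` from `x₀` to `y` of length `T = d_t(x₀, y)`; the polynomial upper barriers of
`end_distSq_barriers_linear` (linear weight `s/T`, so that `Σᵢ bᵢ ≤ 2m − 2T ∫₀ᵀ (s/T)² Ric(γ̇, γ̇) + η/4
≤ 2m + (2/3)KT² + η/4`, as `γ` stays in the ball where `|Ric(γ̇, γ̇)| ≤ K`); the linear left time
barrier `T² + p(t′ − t)` of slope `p = −2T ∫₀ᵀ Ric(γ̇, γ̇) − η/4 ≥ −2KT² − η`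
(`IsRicciFlow.edist_toReal_sq_le_taylor_left`). [cite: Bamler2020Entropy, §9, proof of arXiv Lem. 37] -/
theorem distSq_basepoint_directional_datum (hh : IsContMDiffFamilyOn ∞ h univ)
    (hR : ∀ r, (h r).IsRiemannian) {S : Set ℝ} (hS : S.OrdConnected) (hflow : IsRicciFlow h cov S)
    (_hm : 0 < m) {x₀ y : M} (hne : x₀ ≠ y) {t : ℝ} (ht : t ∈ S) (hleft : ∃ s ∈ S, s < t)
    {K : ℝ} (hK : 0 ≤ K)
    (hRic : ∀ z : M, (h t).edist (hR t) x₀ z ≤ (h t).edist (hR t) x₀ y →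
      ∀ v : TangentSpace 𝓘(ℝ, EuclideanSpace ℝ (Fin m)) z,
        |(cov t).ricci z v v| ≤ K * (h t).val z v v)
    {η : ℝ} (hη : 0 < η) :
    ∃ (ey : Fin (Module.finrank ℝ (EuclideanSpace ℝ (Fin m))) →
        TangentSpace 𝓘(ℝ, EuclideanSpace ℝ (Fin m)) y)
      (By By' : Fin (Module.finrank ℝ (EuclideanSpace ℝ (Fin m))) → ℝ → ℝ)
      (by_ : Fin (Module.finrank ℝ (EuclideanSpace ℝ (Fin m))) → ℝ) (Bt : ℝ → ℝ) (p : ℝ),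
      (∀ i j, (h t).val y (ey i) (ey j) = if i = j then 1 else 0) ∧
      (∀ i, (∀ᶠ σ in 𝓝 (0 : ℝ), HasDerivAt (By i) (By' i σ) σ) ∧ HasDerivAt (By' i) (by_ i) 0 ∧
        By i 0 = ((h t).edist (hR t) x₀ y).toReal ^ 2 ∧
        ∀ᶠ σ in 𝓝 (0 : ℝ),
          ((h t).edist (hR t) x₀ (expMap (h t).leviCivita y (σ • ey i))).toReal ^ 2 ≤ By i σ) ∧
      (HasDerivWithinAt Bt p (Iic t) t ∧ Bt t = ((h t).edist (hR t) x₀ y).toReal ^ 2 ∧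
        ∀ᶠ t' in 𝓝[<] t, ((h t').edist (hR t') x₀ y).toReal ^ 2 ≤ Bt t') ∧
      ∑ i, by_ i ≤ 2 * m + K * ((h t).edist (hR t) x₀ y).toReal ^ 2 + η ∧
      -(2 * K * ((h t).edist (hR t) x₀ y).toReal ^ 2) - η ≤ p := by
  classical
  set g := h t with hg_def
  haveI : Fact ((1 : ℕ∞ω) ≤ (∞ : ℕ∞ω)) := ⟨by exact_mod_cast le_top⟩
  have h2 : (2 : ℕ∞ω) ≤ (∞ : ℕ∞ω) := WithTop.coe_le_coe.mpr le_top
  haveI : CovariantDerivative.ContMDiffCovariantDerivative g.leviCivita 1 :=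
    contMDiffCovariantDerivative_leviCivita_of_two_le g h2
  haveI : CovariantDerivative.ContMDiffCovariantDerivative g.leviCivita ((⊤ : ℕ∞) : ℕ∞ω) :=
    contMDiffCovariantDerivative_leviCivita_infty g le_rfl
  have hc : IsGeodesicallyComplete g.leviCivita := isGeodesicallyComplete_of_compactSpace g h2 (hR t)
  have hg : g.IsRiemannian := hR t
  -- a minimizing unit speed geodesic from `x₀` to `y`, `T = d_t(x₀, y) > 0`
  obtain ⟨u, T, hTpos, hu, hxTu, hT⟩ := exists_unit_minimizing g hg hc hne
  obtain ⟨hγs, hγ0, hspeed⟩ := contMDiff_and_unit_speed_expMap_smul g hc x₀ u hu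
  rw [zero_smul] at hγ0
  set γ : ℝ → M := fun s ↦ expMap g.leviCivita x₀ (s • u) with hγ_def
  have hγ0' : γ 0 = x₀ := by
    show expMap g.leviCivita x₀ ((0 : ℝ) • u) = x₀; rw [zero_smul]; exact hγ0
  have hγT : γ T = y := hxTu
  have hT2 : (g.edist hg x₀ y).toReal ^ 2 = T ^ 2 := by rw [hT]
  -- the slack
  have hε : 0 < η / 4 := by positivity
  -- the spatial barriers at `y` (linear weight)
  obtain ⟨ey, By, By', by_, hony, hBy, hsumy⟩ := end_distSq_barriers_linear g hg hc x₀ u hu hTpos hε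
  rw [hxTu] at hony hBy
  -- the time barrier (flow equation)
  have hspeed' : ∀ s ∈ Icc (0 : ℝ) T, (h t).val (γ s)
      (velocity 𝓘(ℝ, EuclideanSpace ℝ (Fin m)) γ s) (velocity 𝓘(ℝ, EuclideanSpace ℝ (Fin m)) γ s) = 1 :=
    fun s _ ↦ hspeed s
  have hdistγ : ((h t).edist (hR t) (γ 0) (γ T)).toReal = T := by rw [hγ0', hγT]; exact hT
  have htime := hflow.edist_toReal_sq_le_taylor_left hh hR hS ht hleft hγs hTpos hspeed' hdistγ
    (η / 4) hε
  rw [hγ0', hγT] at htime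
  -- the Ricci integrand along `γ`: `(cov t).ricci = g.ricci`
  set Rfun : ℝ → ℝ := fun s ↦ g.leviCivita.ricci (γ s) (velocity 𝓘(ℝ, EuclideanSpace ℝ (Fin m)) γ s)
    (velocity 𝓘(ℝ, EuclideanSpace ℝ (Fin m)) γ s) with hRfun
  have hcovR : ∀ s, (cov t).ricci (γ s) (velocity 𝓘(ℝ, EuclideanSpace ℝ (Fin m)) γ s)
      (velocity 𝓘(ℝ, EuclideanSpace ℝ (Fin m)) γ s) = Rfun s := by
    intro s
    have := IsLeviCivita.ricci_eq_ricci (hflow.isLeviCivita t ht) h2 (γ s)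
    simp only [hRfun, this]
    rfl
  have hIcov : ∫ s in (0 : ℝ)..T, (cov t).ricci (γ s) (velocity 𝓘(ℝ, EuclideanSpace ℝ (Fin m)) γ s)
      (velocity 𝓘(ℝ, EuclideanSpace ℝ (Fin m)) γ s) = ∫ s in (0 : ℝ)..T, Rfun s :=
    intervalIntegral.integral_congr fun s _ ↦ hcovR s
  rw [hIcov] at htime
  have hRc : Continuous Rfun := by
    have hTl := contMDiff_lift_velocity_of_contMDiff (I := 𝓘(ℝ, EuclideanSpace ℝ (Fin m))) hγs
    exact (show ContMDiff 𝓘(ℝ, ℝ) 𝓘(ℝ, ℝ) ∞ _ from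
      fun s ↦ contMDiffAt_ricci_apply_along g (hTl s) (hTl s)).continuous
  -- `|Ric(γ̇, γ̇)| ≤ K` on `[0, T]`: `γ` stays in the ball `{d(x₀, ·) ≤ d(x₀, y)}`
  have hTtop : g.edist hg x₀ y ≠ ⊤ := by
    intro htop
    rw [htop, ENNReal.toReal_top] at hT
    exact hTpos.ne' hT.symm
  have hRK : ∀ s ∈ Icc (0 : ℝ) T, |Rfun s| ≤ K := by
    intro s hs
    obtain ⟨hfin, hle⟩ := edist_toReal_le_of_unit_speed g hg hγs hs.1 hspeed
    rw [hγ0'] at hfin hle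
    have hball : g.edist hg x₀ (γ s) ≤ g.edist hg x₀ y := by
      rw [← ENNReal.ofReal_toReal hfin, ← ENNReal.ofReal_toReal hTtop, hT]
      exact ENNReal.ofReal_le_ofReal (hle.trans hs.2)
    have h1 := hRic (γ s) hball (velocity 𝓘(ℝ, EuclideanSpace ℝ (Fin m)) γ s)
    rw [hcovR s, hspeed s, mul_one] at h1
    exact h1
  -- the two Ricci integrals
  have hI1 : 2 * T * (∫ s in (0 : ℝ)..T, Rfun s) ≤ 2 * T * (K * T) := by
    refine mul_le_mul_of_nonneg_left ?_ (by positivity)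
    have h1 : ∫ s in (0 : ℝ)..T, Rfun s ≤ ∫ _ in (0 : ℝ)..T, K :=
      intervalIntegral.integral_mono_on hTpos.le (hRc.intervalIntegrable _ _)
        (continuous_const.intervalIntegrable _ _) (fun s hs ↦ (abs_le.1 (hRK s hs)).2)
    rwa [intervalIntegral.integral_const, smul_eq_mul, sub_zero, mul_comm] at h1
  have hI2 : -(2 * T * ∫ s in (0 : ℝ)..T, (s / T) ^ 2 * Rfun s) ≤ 2 * T * (K * T / 3) := by
    have hwc : Continuous fun s : ℝ ↦ (s / T) ^ 2 := (continuous_id.div_const T).pow 2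
    have h1 : ∫ s in (0 : ℝ)..T, (s / T) ^ 2 * (-K) ≤ ∫ s in (0 : ℝ)..T, (s / T) ^ 2 * Rfun s :=
      intervalIntegral.integral_mono_on hTpos.le
        ((hwc.mul continuous_const).intervalIntegrable _ _) ((hwc.mul hRc).intervalIntegrable _ _)
        (fun s hs ↦ mul_le_mul_of_nonneg_left (abs_le.1 (hRK s hs)).1 (sq_nonneg (s / T)))
    have hsq : ∫ s in (0 : ℝ)..T, (s / T) ^ 2 * (-K) = -(K * T / 3) := by
      have e1 : (fun s : ℝ ↦ (s / T) ^ 2 * (-K)) = fun s ↦ (-K / T ^ 2) * s ^ 2 := by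
        funext s
        field_simp
      rw [e1, intervalIntegral.integral_const_mul, integral_pow]
      norm_num
      field_simp
    rw [hsq] at h1
    nlinarith [h1, hTpos]
  -- the linear time barrier
  set p : ℝ := -(2 * T * ∫ s in (0 : ℝ)..T, Rfun s) - η / 4 with hp
  set Bt : ℝ → ℝ := fun t' ↦ (g.edist hg x₀ y).toReal ^ 2 + p * (t' - t) with hBt
  have hBtd : HasDerivWithinAt Bt p (Iic t) t := by
    have := (((hasDerivAt_id' t).sub_const t).const_mul p).const_add ((g.edist hg x₀ y).toReal ^ 2)
    exact (this.congr_deriv (by ring)).hasDerivWithinAt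
  -- assembly
  refine ⟨ey, By, By', by_, Bt, p, hony, fun i ↦ ?_,
    ⟨hBtd, by simp only [hBt, sub_self, mul_zero, add_zero]; rfl, ?_⟩, ?_, ?_⟩
  · obtain ⟨hd1, hd2, hB0, hdom⟩ := hBy i
    exact ⟨hd1, hd2, by rw [hB0]; exact hT2.symm, hdom⟩
  · filter_upwards [htime] with t' ht'
    show _ ≤ (g.edist hg x₀ y).toReal ^ 2 + p * (t' - t)
    convert ht' using 2
  · -- the spatial inequality
    have hfr : (Module.finrank ℝ (EuclideanSpace ℝ (Fin m)) : ℝ) = m := by simp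
    rw [hfr] at hsumy
    change ∑ i, by_ i ≤ 2 * (m : ℝ) - 2 * T * (∫ s in (0 : ℝ)..T, (s / T) ^ 2 * Rfun s) + η / 4
      at hsumy
    rw [hT2]
    have hKT : 0 ≤ K * T ^ 2 := by positivity
    nlinarith [hsumy, hI2, hKT, hη]
  · -- the time inequality
    rw [hT2]
    have hKT : 0 ≤ K * T ^ 2 := by positivity
    nlinarith [hI1, hKT, hη]

end Datum

end Literature.Geometry.Riemannian

end
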